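import Mathlib
import HarnessLib
import Summits.HubbardSuperconductivity.HubbardSuperconductivity.Theorems.KLProgrammeC4aBubblePartition

/-!
# Route `KLProgramme` — crux C4a, S3 brick (B4, DIRECT SHEET): the FINER-LINE SPLIT of the co-moving bubble — `p̂ ↦ R − p̂` symmetry of the zone-box pair
# integral against a two-band partition `σ(a,b) + σ(b,a) = 1`

Cell `gate-hubbard-kl`, seat hubbard-kl-k3c3-p3 (g25; row «implicit-function / monotonicity route for μ(n)»).  Located brick «(B4)-DIRECT-COUNT» (memo
HOME/hubbard-kl-k3c3-p3/B4-DIRECT-COUNT.md §2): the representation step of the direct-sheet power counting.  `…C4aEnvelopePreservation` pays every base-angle derivative on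
the partner line by the partner's own scale PROVIDED the partner is the coarser line of the pair (`|e| ≤ |ē|` up to constants); the loop/partner roles are exchanged
by the zone-box swap `p̂ ↦ R − p̂` (`…C4aBubblePartition.setIntegral_zoneBox_comp_sub`), so with ANY continuous two-band partition `σ(a,b) + σ(b,a) = 1` (e.g. a smooth step of
`(|b| − |a|)/(|a| + |b|)`, selecting `|a| ≲ |b|`) the pair integral splits into two pieces each of which carries its level coordinates on the (smoothly selected) finer line:

* `zoneBox_pair_kernel_swap` — `∫ G(e_K q̂, e_K(R − q̂)) = ∫ G(e_K(R − q̂), e_K q̂)` over the zone box `(−π,π)²`, for every continuous two-band kernel `G`;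
* **`zoneBox_pair_kernel_split`** — `∫ G(e, ē) = ∫ (G(e, ē) + G(ē, e))·σ(e, ē)` (`e = e_K q̂`, `ē = e_K(R − q̂)`) whenever `σ(a,b) + σ(b,a) = 1`;
* `zoneBox_pair_kernel_split_symm` — for a symmetric kernel `∫ G(e, ē) = 2·∫ G(e, ē)·σ(e, ē)`;
* `zoneBox_bubble_eq_finer_split` / `_same` — the bubble instances `G(a,b) = Ψ₁(a)Ψ₂(b)`: `∫Ψ₁(e)Ψ₂(ē) = ∫(Ψ₁(e)Ψ₂(ē) + Ψ₂(e)Ψ₁(ē))σ(e,ē)`, and `= 2∫Ψ(e)Ψ(ē)σ(e,ē)` for one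
  propagator profile (the Matsubara-symmetrised pp pair).

Each piece is then put in level coordinates by `…C4aBubbleTubeRepGeneric.tube_eq_levelIntegral_recentre` / `zoneBoxIco_profile_eq_levelIntegral` (the weight `σ(e, ē)` is just
another smooth factor of the vertex weight `W`).  Pure measure-theory bookkeeping on landed objects; nothing about the model's sizes; nothing asserts (C), K3 or superconductivity.
References: FST II CPAM 51 (1998) §3; BGM 2006 §2.4, §3 [cite: BenfattoGiulianiMastropietro2006].
-/

noncomputable section

namespace Summit.HubbardSuperconductivity.HubbardSuperconductivity.Theorems.C4a

set_option linter.dupNamespace false -- summit = problem name (single-conjunct summit), D-0017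

open Real Set MeasureTheory
open Literature.MathematicalPhysics.QuantumLattice
open Summit.HubbardSuperconductivity.HubbardSuperconductivity.Theorems.KLRegimeSplit
open Summit.HubbardSuperconductivity.HubbardSuperconductivity.Theorems.DispersionFlow

/-! ## §1 Two-band kernels on the zone box: swap and split -/

section Kernel

/-- **Swap of a two-band kernel**: `∫_{(−π,π)²} G(e_K q̂, e_K(R − q̂)) dq̂ = ∫_{(−π,π)²} G(e_K(R − q̂), e_K q̂) dq̂` for every continuous `G : ℝ × ℝ → ℂ`
(the substitution `q̂ ↦ R − q̂` on the torus; `e_K` is `2π`-periodic in each coordinate). -/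
theorem zoneBox_pair_kernel_swap (μ : ℝ) (K : TrigPolyC4v) {G : ℝ × ℝ → ℂ} (hG : Continuous G) (R : Momentum) :
    ∫ p in Ioo (-π) π ×ˢ Ioo (-π) π, G (frameLevel μ K (WithLp.toLp 2 ![p.1, p.2]), frameLevel μ K (R - WithLp.toLp 2 ![p.1, p.2])) =
      ∫ p in Ioo (-π) π ×ˢ Ioo (-π) π, G (frameLevel μ K (R - WithLp.toLp 2 ![p.1, p.2]), frameLevel μ K (WithLp.toLp 2 ![p.1, p.2])) := by
  have he : Continuous (frameLevel μ K) := (EngineV8.contDiff_frameLevel μ K (n := 0)).continuous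
  set F : ℝ × ℝ → ℂ := fun p => G (frameLevel μ K (R - WithLp.toLp 2 ![p.1, p.2]), frameLevel μ K (WithLp.toLp 2 ![p.1, p.2])) with hFdef
  have hF : Continuous F := hG.comp ((he.comp (continuous_const.sub continuous_coordToLp)).prodMk (he.comp continuous_coordToLp))
  have hperR : ∀ (j : Fin 2) (q : Momentum), frameLevel μ K (R - (q + EuclideanSpace.single j (2 * π))) = frameLevel μ K (R - q) := fun j q => by
    rw [← sub_sub]; exact periodic_single_neg (frameLevel_periodic_single μ K) j (R - q)
  have h1 : ∀ x y, F (x + 2 * π, y) = F (x, y) := fun x y => by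
    simp only [hFdef, toLp_pair_add_two_pi_fst, hperR, frameLevel_periodic_single]
  have h2 : ∀ x y, F (x, y + 2 * π) = F (x, y) := fun x y => by
    simp only [hFdef, toLp_pair_add_two_pi_snd, hperR, frameLevel_periodic_single]
  have hswap := setIntegral_zoneBox_comp_sub hF h1 h2 (R 0, R 1)
  have hSF : ∀ p : ℝ × ℝ, F ((R 0, R 1) - p) = G (frameLevel μ K (WithLp.toLp 2 ![p.1, p.2]), frameLevel μ K (R - WithLp.toLp 2 ![p.1, p.2])) := fun p => by
    have hR : R = WithLp.toLp 2 ![R 0, R 1] := by ext i; fin_cases i <;> simp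
    have hc : (WithLp.toLp 2 ![((R 0, R 1) - p).1, ((R 0, R 1) - p).2] : Momentum) = R - WithLp.toLp 2 ![p.1, p.2] := by
      rw [Prod.fst_sub, Prod.snd_sub, toLp_pair_sub, ← hR]
    simp only [hFdef, hc, sub_sub_cancel]
  simp only [hSF] at hswap
  exact hswap

/-- **FINER-LINE SPLIT of a two-band kernel**: if `σ(a,b) + σ(b,a) = 1` for all `a, b` (`σ` continuous), then
`∫ G(e, ē) = ∫ (G(e, ē) + G(ē, e))·σ(e, ē)` over the zone box (`e = e_K q̂`, `ē = e_K(R − q̂)`). -/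
theorem zoneBox_pair_kernel_split (μ : ℝ) (K : TrigPolyC4v) {G σ : ℝ × ℝ → ℂ} (hG : Continuous G) (hσ : Continuous σ)
    (hsym : ∀ a b, σ (a, b) + σ (b, a) = 1) (R : Momentum) :
    ∫ p in Ioo (-π) π ×ˢ Ioo (-π) π, G (frameLevel μ K (WithLp.toLp 2 ![p.1, p.2]), frameLevel μ K (R - WithLp.toLp 2 ![p.1, p.2])) =
      ∫ p in Ioo (-π) π ×ˢ Ioo (-π) π,
        (G (frameLevel μ K (WithLp.toLp 2 ![p.1, p.2]), frameLevel μ K (R - WithLp.toLp 2 ![p.1, p.2])) +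
          G (frameLevel μ K (R - WithLp.toLp 2 ![p.1, p.2]), frameLevel μ K (WithLp.toLp 2 ![p.1, p.2]))) *
          σ (frameLevel μ K (WithLp.toLp 2 ![p.1, p.2]), frameLevel μ K (R - WithLp.toLp 2 ![p.1, p.2])) := by
  have he : Continuous (frameLevel μ K) := (EngineV8.contDiff_frameLevel μ K (n := 0)).continuous
  have hq : Continuous fun p : ℝ × ℝ => frameLevel μ K (WithLp.toLp 2 ![p.1, p.2]) := he.comp continuous_coordToLp
  have hRq : Continuous fun p : ℝ × ℝ => frameLevel μ K (R - WithLp.toLp 2 ![p.1, p.2]) := he.comp (continuous_const.sub continuous_coordToLp)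
  -- the two halves of the partition
  have hI1 : IntegrableOn (fun p : ℝ × ℝ => G (frameLevel μ K (WithLp.toLp 2 ![p.1, p.2]), frameLevel μ K (R - WithLp.toLp 2 ![p.1, p.2])) *
      σ (frameLevel μ K (WithLp.toLp 2 ![p.1, p.2]), frameLevel μ K (R - WithLp.toLp 2 ![p.1, p.2]))) (Ioo (-π) π ×ˢ Ioo (-π) π) :=
    integrableOn_zoneBox_of_continuous ((hG.comp (hq.prodMk hRq)).mul (hσ.comp (hq.prodMk hRq)))
  have hI2 : IntegrableOn (fun p : ℝ × ℝ => G (frameLevel μ K (WithLp.toLp 2 ![p.1, p.2]), frameLevel μ K (R - WithLp.toLp 2 ![p.1, p.2])) *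
      σ (frameLevel μ K (R - WithLp.toLp 2 ![p.1, p.2]), frameLevel μ K (WithLp.toLp 2 ![p.1, p.2]))) (Ioo (-π) π ×ˢ Ioo (-π) π) :=
    integrableOn_zoneBox_of_continuous ((hG.comp (hq.prodMk hRq)).mul (hσ.comp (hRq.prodMk hq)))
  have hI2' : IntegrableOn (fun p : ℝ × ℝ => G (frameLevel μ K (R - WithLp.toLp 2 ![p.1, p.2]), frameLevel μ K (WithLp.toLp 2 ![p.1, p.2])) *
      σ (frameLevel μ K (WithLp.toLp 2 ![p.1, p.2]), frameLevel μ K (R - WithLp.toLp 2 ![p.1, p.2]))) (Ioo (-π) π ×ˢ Ioo (-π) π) :=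
    integrableOn_zoneBox_of_continuous ((hG.comp (hRq.prodMk hq)).mul (hσ.comp (hq.prodMk hRq)))
  -- step 1: insert the partition of unity
  have hstep1 : ∫ p in Ioo (-π) π ×ˢ Ioo (-π) π, G (frameLevel μ K (WithLp.toLp 2 ![p.1, p.2]), frameLevel μ K (R - WithLp.toLp 2 ![p.1, p.2])) =
      (∫ p in Ioo (-π) π ×ˢ Ioo (-π) π, G (frameLevel μ K (WithLp.toLp 2 ![p.1, p.2]), frameLevel μ K (R - WithLp.toLp 2 ![p.1, p.2])) *
          σ (frameLevel μ K (WithLp.toLp 2 ![p.1, p.2]), frameLevel μ K (R - WithLp.toLp 2 ![p.1, p.2]))) +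
      ∫ p in Ioo (-π) π ×ˢ Ioo (-π) π, G (frameLevel μ K (WithLp.toLp 2 ![p.1, p.2]), frameLevel μ K (R - WithLp.toLp 2 ![p.1, p.2])) *
          σ (frameLevel μ K (R - WithLp.toLp 2 ![p.1, p.2]), frameLevel μ K (WithLp.toLp 2 ![p.1, p.2])) := by
    rw [← integral_add hI1 hI2]
    refine setIntegral_congr_fun (measurableSet_Ioo.prod measurableSet_Ioo) fun p _ => ?_
    simp only
    rw [← mul_add, hsym, mul_one]
  -- step 2: swap the second half
  have hstep2 := zoneBox_pair_kernel_swap μ K (G := fun x : ℝ × ℝ => G x * σ (x.2, x.1)) (hG.mul (hσ.comp (continuous_snd.prodMk continuous_fst))) R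
  simp only at hstep2
  rw [hstep1, hstep2, ← integral_add hI1 hI2']
  refine setIntegral_congr_fun (measurableSet_Ioo.prod measurableSet_Ioo) fun p _ => ?_
  simp only
  ring

/-- **… for a SYMMETRIC kernel** (`G(a,b) = G(b,a)`): `∫ G(e, ē) = 2·∫ G(e, ē)·σ(e, ē)`. -/
theorem zoneBox_pair_kernel_split_symm (μ : ℝ) (K : TrigPolyC4v) {G σ : ℝ × ℝ → ℂ} (hG : Continuous G) (hσ : Continuous σ)
    (hGsym : ∀ a b, G (a, b) = G (b, a)) (hsym : ∀ a b, σ (a, b) + σ (b, a) = 1) (R : Momentum) :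
    ∫ p in Ioo (-π) π ×ˢ Ioo (-π) π, G (frameLevel μ K (WithLp.toLp 2 ![p.1, p.2]), frameLevel μ K (R - WithLp.toLp 2 ![p.1, p.2])) =
      2 * ∫ p in Ioo (-π) π ×ˢ Ioo (-π) π, G (frameLevel μ K (WithLp.toLp 2 ![p.1, p.2]), frameLevel μ K (R - WithLp.toLp 2 ![p.1, p.2])) *
          σ (frameLevel μ K (WithLp.toLp 2 ![p.1, p.2]), frameLevel μ K (R - WithLp.toLp 2 ![p.1, p.2])) := by
  rw [zoneBox_pair_kernel_split μ K hG hσ hsym R, ← integral_const_mul]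
  refine setIntegral_congr_fun (measurableSet_Ioo.prod measurableSet_Ioo) fun p _ => ?_
  simp only
  rw [hGsym (frameLevel μ K (R - WithLp.toLp 2 ![p.1, p.2]))]
  ring

end Kernel

/-! ## §2 The bubble instances -/

section Bubble

/-- **FINER-LINE SPLIT OF THE CO-MOVING BUBBLE** (pp, any pair momentum `R`, two propagator profiles): for continuous `Ψ₁, Ψ₂` and a continuous two-band partition
`σ(a,b) + σ(b,a) = 1`,
`∫ Ψ₁(e_K q̂)Ψ₂(e_K(R−q̂)) = ∫ (Ψ₁(e_K q̂)Ψ₂(e_K(R−q̂)) + Ψ₂(e_K q̂)Ψ₁(e_K(R−q̂)))·σ(e_K q̂, e_K(R−q̂))` over `(−π,π)²` — in each summand the line selected by `σ` as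
the finer one carries the integration variable. -/
theorem zoneBox_bubble_eq_finer_split (μ : ℝ) (K : TrigPolyC4v) {Ψ₁ Ψ₂ : ℝ → ℂ} (hΨ₁ : Continuous Ψ₁) (hΨ₂ : Continuous Ψ₂)
    {σ : ℝ × ℝ → ℂ} (hσ : Continuous σ) (hsym : ∀ a b, σ (a, b) + σ (b, a) = 1) (R : Momentum) :
    ∫ p in Ioo (-π) π ×ˢ Ioo (-π) π, Ψ₁ (frameLevel μ K (WithLp.toLp 2 ![p.1, p.2])) * Ψ₂ (frameLevel μ K (R - WithLp.toLp 2 ![p.1, p.2])) =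
      ∫ p in Ioo (-π) π ×ˢ Ioo (-π) π,
        (Ψ₁ (frameLevel μ K (WithLp.toLp 2 ![p.1, p.2])) * Ψ₂ (frameLevel μ K (R - WithLp.toLp 2 ![p.1, p.2])) +
          Ψ₂ (frameLevel μ K (WithLp.toLp 2 ![p.1, p.2])) * Ψ₁ (frameLevel μ K (R - WithLp.toLp 2 ![p.1, p.2]))) *
          σ (frameLevel μ K (WithLp.toLp 2 ![p.1, p.2]), frameLevel μ K (R - WithLp.toLp 2 ![p.1, p.2])) := by
  have h := zoneBox_pair_kernel_split μ K (G := fun x : ℝ × ℝ => Ψ₁ x.1 * Ψ₂ x.2) ((hΨ₁.comp continuous_fst).mul (hΨ₂.comp continuous_snd)) hσ hsym R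
  simp only at h
  rw [h]
  refine setIntegral_congr_fun (measurableSet_Ioo.prod measurableSet_Ioo) fun p _ => ?_
  simp only
  ring

/-- **… with one propagator profile** (`Ψ₁ = Ψ₂ = Ψ`, e.g. the Matsubara-symmetrised pair): `∫ Ψ(e_K q̂)Ψ(e_K(R−q̂)) = 2·∫ Ψ(e_K q̂)Ψ(e_K(R−q̂))·σ(e_K q̂, e_K(R−q̂))`. -/
theorem zoneBox_bubble_eq_finer_split_same (μ : ℝ) (K : TrigPolyC4v) {Ψ : ℝ → ℂ} (hΨ : Continuous Ψ)
    {σ : ℝ × ℝ → ℂ} (hσ : Continuous σ) (hsym : ∀ a b, σ (a, b) + σ (b, a) = 1) (R : Momentum) :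
    ∫ p in Ioo (-π) π ×ˢ Ioo (-π) π, Ψ (frameLevel μ K (WithLp.toLp 2 ![p.1, p.2])) * Ψ (frameLevel μ K (R - WithLp.toLp 2 ![p.1, p.2])) =
      2 * ∫ p in Ioo (-π) π ×ˢ Ioo (-π) π,
        Ψ (frameLevel μ K (WithLp.toLp 2 ![p.1, p.2])) * Ψ (frameLevel μ K (R - WithLp.toLp 2 ![p.1, p.2])) *
          σ (frameLevel μ K (WithLp.toLp 2 ![p.1, p.2]), frameLevel μ K (R - WithLp.toLp 2 ![p.1, p.2])) := by
  have h := zoneBox_pair_kernel_split_symm μ K (G := fun x : ℝ × ℝ => Ψ x.1 * Ψ x.2) ((hΨ.comp continuous_fst).mul (hΨ.comp continuous_snd)) hσ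
    (fun a b => mul_comm _ _) hsym R
  simp only at h
  exact h

end Bubble

end Summit.HubbardSuperconductivity.HubbardSuperconductivity.Theorems.C4a

end
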